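import Summits.QuantumAdvantage.QuantumAdvantage.Theses.DarkClassGroups
import Summits.QuantumAdvantage.QuantumAdvantage.Theorems.DarkClassGroupsPrimeClassesSpreadInputs
import Summits.QuantumAdvantage.QuantumAdvantage.Theorems.DarkClassGroupsPrimeClassesSpreadChebyshev
import Summits.QuantumAdvantage.QuantumAdvantage.Theorems.LinnikCubicClassGroupsDegreeOnePrimesEscapeCubicEscapeLever
import Summits.QuantumAdvantage.QuantumAdvantage.Theorems.LinnikCubicClassGroupsDegreeOnePrimesEscapePerCharacterDeficitLocal
import Summits.QuantumAdvantage.QuantumAdvantage.Theorems.LinnikCubicClassGroupsDegreeOnePrimesEscapeLowerPIT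
import Summits.QuantumAdvantage.QuantumAdvantage.Theorems.DegreeOnePrimesEscape.Negative.EscapeCounting
import Literature.NumberTheory.LFunctions.LogIntegralProofs
import HarnessLib

/-!
# Crux `PrimeClassesSpread` (stmt-QuantumAdvantage-11613, route `DarkClassGroups`): PROVED

Topic `Summits/QuantumAdvantage/QuantumAdvantage/Theorems`; closes the crux
`Summit.QuantumAdvantage.QuantumAdvantage.Theses.DarkClassGroups.PrimeClassesSpread` BY NAME.
HONEST FRAMING: the value of this file is a THEOREM (kernel-checked; conditional only on the route's
registered hypothesis (i) `NoSiegelZerosOddQuadratic`, which is the antecedent OF the statement) — not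
summit progress.

**Statement.** (i) ⇒ there is `N₀` such that for every imaginary quadratic field `K` with `|d_K| ≥ N₀` and
every `x` with `log x ≥ log²|d_K|`, writing `P₁(x)` for the prime ideals of `𝓞 K` of PRIME norm `≤ x`:
(a) `π(x) ≤ 3 · #P₁(x)`; (b) `4 · #{P ∈ P₁(x) : [P] ∈ M} ≤ 3 · #P₁(x)` for every proper subgroup
`M < Cl(𝓞 K)`.

**Proof** (NOT the printed route via Thorner–Zaman 2019 Thm 1.4 with its Deuring–Heilbronn relative error,
but the one-sided Linnik–Stark machinery of the cell `linnik-cubic` of route `LinnikCubicClassGroups`, run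
at degree `2`).  Inputs, all tree theorems: T4(2) `perCharacterDeficitκ_of_le_four 2` — for `K` of degree
`2` with `κ_K ≥ Q^{−1}` (`Q = 4|d_K|`), every class-group character `χ ≠ 1` and `x ≥ Q^{C₂}`,
`8 · Σ_C Re χ(C) · #{P ∈ P₁(x) : [P] = C} ≤ Li(x)` (a real zero of `L(s, χ)` only DEPRESSES the sum — no
Siegel hypothesis for `χ ≠ 1`, in particular none for the genus characters); T5(2)
`lowerPITκ_of_le_three 2` — for `x ≥ Q^{C₁}`, `29 Li(x) ≤ 32 π_K(x)` unless `ζ_K` has a real zero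
`β₁ ∈ (1 − 1/(8 log Q), 1)` with `(1 − β₁) log x < 4`; the residue bound `κ_K ≥ Q^{−1}`
(`condQn_rpow_neg_one_le_residue`, class number formula); and, from (i), `ζ_K(σ) = ζ(σ)L(σ, χ_{d_K}) ≠ 0`
on `(1 − c/log|d_K|, 1)` (`zetaCont_ne_zero_of_noSiegel`), so that in the range `log x ≥ log²|d_K|`,
`|d_K| ≥ N₀ = ⌈exp(max(2 max(C₁,C₂,1), 4/c, 25))⌉` the nearby zero has `(1 − β₁) log x ≥ c log|d_K| ≥ 4` —
impossible; hence `π_K(x) ≥ (29/32) Li(x)` and `#P₁(x) ≥ π_K(x) − 2(√x + 1)`.  Then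
(a) follows from Chebyshev with cut-off `y = x^{9/10}`: `π(x) ≤ (10/9)(log 4) x/log x + x^{9/10}`
(`primeCounting_le_log4_mul_div_log_add`), `Li(x) ≥ x/log x − 2`, `3 · 29/32 = 2.71… > 1.54…`, the lower-order
terms being `≤ x/log x` for `log x ≥ 625`; and (b) from the subgroup-orthogonality lever
`CubicEscape.index_mul_sum_filter_mem_le`: `m · #{[P] ∈ M} ≤ #P₁ + (m − 1) Li/8`, `m = [Cl : M] ≥ 2`, so
`4 · #{[P] ∈ M} ≤ 2 #P₁ + Li/2 ≤ 3 #P₁` as `#P₁ ≥ Li/2`.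
-/

noncomputable section

open scoped NumberField nonZeroDivisors
open Literature.NumberTheory.LFunctions Literature.NumberTheory.LFunctions.NumberField
open Summit.QuantumAdvantage.QuantumAdvantage.Theorems.DegreeOnePrimesEscape
open Summit.QuantumAdvantage.QuantumAdvantage.Theorems.DegreeOnePrimesEscape.Negative
  (degOneInClass degOneInClass_finite degOneInClass_disjoint)

namespace Summit.QuantumAdvantage.QuantumAdvantage.Theorems.PrimeClassesSpread

/-! ### Counting over the class group -/

open scoped Classical in
/-- `#P₁(x) = Σ_C #{P ∈ P₁(x) : [P] = C}` (a prime of prime norm is nonzero). [folklore] -/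
theorem ncard_primeNorm_eq_sum (K : Type) [Field K] [NumberField K] (x : ℕ) :
    Set.ncard {P : Ideal (𝓞 K) | P.IsPrime ∧ (Ideal.absNorm P).Prime ∧ Ideal.absNorm P ≤ x}
      = ∑ C : ClassGroup (𝓞 K), (degOneInClass K x C).ncard := by
  rw [← ncard_degOne_eq_sum_classes K x]
  congr 1
  ext P
  simp only [Set.mem_setOf_eq]
  constructor
  · rintro ⟨h1, h2, h3⟩
    refine ⟨h1, ?_, h2, h3⟩
    rintro rfl
    rw [Ideal.absNorm_bot] at h2
    exact Nat.not_prime_zero h2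
  · rintro ⟨h1, -, h2, h3⟩
    exact ⟨h1, h2, h3⟩

open scoped Classical in
/-- `#{P ∈ P₁(x) : [P] ∈ M} = Σ_{C ∈ M} #{P ∈ P₁(x) : [P] = C}`. [folklore] -/
theorem ncard_primeNorm_mem_eq_sum (K : Type) [Field K] [NumberField K] (x : ℕ)
    (M : Subgroup (ClassGroup (𝓞 K))) :
    Set.ncard {P : Ideal (𝓞 K) | P.IsPrime ∧ (Ideal.absNorm P).Prime ∧ Ideal.absNorm P ≤ x ∧
        ∃ hP : P ∈ nonZeroDivisors (Ideal (𝓞 K)), ClassGroup.mk0 ⟨P, hP⟩ ∈ M}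
      = ∑ C ∈ Finset.univ.filter (fun C : ClassGroup (𝓞 K) => C ∈ M), (degOneInClass K x C).ncard := by
  set S := Finset.univ.filter (fun C : ClassGroup (𝓞 K) => C ∈ M) with hS
  set t : ClassGroup (𝓞 K) → Finset (Ideal (𝓞 K)) :=
    fun C => (degOneInClass_finite K x C).toFinset with ht
  have hU : {P : Ideal (𝓞 K) | P.IsPrime ∧ (Ideal.absNorm P).Prime ∧ Ideal.absNorm P ≤ x ∧
        ∃ hP : P ∈ nonZeroDivisors (Ideal (𝓞 K)), ClassGroup.mk0 ⟨P, hP⟩ ∈ M} = ↑(S.biUnion t) := by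
    ext P
    simp only [Finset.coe_biUnion, Finset.mem_coe, hS, Finset.mem_filter, Finset.mem_univ, true_and,
      Set.mem_iUnion, ht, Set.Finite.coe_toFinset, degOneInClass, Set.mem_setOf_eq, exists_prop]
    constructor
    · rintro ⟨h1, h2, h3, hP, h4⟩
      exact ⟨ClassGroup.mk0 ⟨P, hP⟩, h4, h1, h2, h3, hP, rfl⟩
    · rintro ⟨C, hC, h1, h2, h3, hP, rfl⟩
      exact ⟨h1, h2, h3, hP, hC⟩
  have hdisj : (S : Set (ClassGroup (𝓞 K))).PairwiseDisjoint t := by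
    intro C _ C' _ hne
    rw [Function.onFun, Finset.disjoint_coe.symm]
    simpa [ht] using degOneInClass_disjoint K x hne
  rw [hU, Set.ncard_coe_finset, Finset.card_biUnion hdisj]
  refine Finset.sum_congr rfl fun C _ => ?_
  rw [ht, Set.ncard_eq_toFinset_card _ (degOneInClass_finite K x C)]

/-! ### Numerics: the lower-order terms in the range `log x ≥ 625` -/

/-- For `u ≥ 625`: `3u ≤ e^{u/10}`, `18u ≤ e^{u/2}`, `36u ≤ e^{u}` (from `e^t ≥ t²/2`). [folklore] -/
theorem linear_le_exp {u : ℝ} (hu : 625 ≤ u) :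
    3 * u ≤ Real.exp (u / 10) ∧ 18 * u ≤ Real.exp (u / 2) ∧ 36 * u ≤ Real.exp u := by
  have h2 : ∀ t : ℝ, 0 ≤ t → t ^ 2 / 2 ≤ Real.exp t := fun t ht ↦ by
    have := Real.pow_div_factorial_le_exp t ht 2
    simpa [Nat.factorial] using this
  refine ⟨?_, ?_, ?_⟩
  · have := h2 (u / 10) (by linarith)
    nlinarith
  · have := h2 (u / 2) (by linarith)
    nlinarith
  · have := h2 u (by linarith)
    nlinarith

/-- **The lower-order terms are `≤ x/log x`** for `x > 0` with `log x ≥ 625`: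
`x^{9/10} + 6√x + 12 ≤ x/log x`. [folklore] -/
theorem lowerOrder_le {x : ℝ} (hx0 : 0 < x) (hx : 625 ≤ Real.log x) :
    x ^ ((9 : ℝ) / 10) + 6 * Real.sqrt x + 12 ≤ x / Real.log x := by
  set u := Real.log x with hu
  have hupos : 0 < u := by linarith
  obtain ⟨hA, hB, hC⟩ := linear_le_exp hx
  have hxexp : x = Real.exp u := by rw [hu, Real.exp_log hx0]
  have h9 : x ^ ((9 : ℝ) / 10) = Real.exp (u * (9 / 10)) := by
    rw [Real.rpow_def_of_pos hx0]
  have hs : Real.sqrt x = Real.exp (u / 2) := by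
    rw [Real.sqrt_eq_rpow, Real.rpow_def_of_pos hx0, hu]; ring_nf
  rw [h9, hs, le_div_iff₀ hupos, hxexp]
  have e1 : Real.exp u = Real.exp (u * (9 / 10)) * Real.exp (u / 10) := by
    rw [← Real.exp_add]; ring_nf
  have e2 : Real.exp u = Real.exp (u / 2) * Real.exp (u / 2) := by
    rw [← Real.exp_add]; ring_nf
  have hp9 : 0 < Real.exp (u * (9 / 10)) := Real.exp_pos _
  have hp5 : 0 < Real.exp (u / 2) := Real.exp_pos _
  have h1' : Real.exp (u * (9 / 10)) * u ≤ Real.exp u / 3 := by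
    rw [e1]; nlinarith
  have h2' : 6 * Real.exp (u / 2) * u ≤ Real.exp u / 3 := by
    rw [e2]; nlinarith
  have h3' : 12 * u ≤ Real.exp u / 3 := by linarith
  nlinarith


/-! ### The crux -/

set_option maxHeartbeats 800000 in
open scoped Classical in
/-- **`PrimeClassesSpread` (stmt-QuantumAdvantage-11613), PROVED**: under (i) `NoSiegelZerosOddQuadratic`,
for every imaginary quadratic field `K` with `|d_K| ≥ N₀` and every `x` with `log x ≥ log²|d_K|`,
(a) `π(x) ≤ 3 · #P₁(x)` and (b) `4 · #{P ∈ P₁(x) : [P] ∈ M} ≤ 3 · #P₁(x)` for every proper subgroup `M` of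
`Cl(𝓞 K)`, where `P₁(x)` is the set of prime ideals of prime norm `≤ x`.  One-sided Linnik–Stark machinery
at degree `2` (see the module docstring); (i) is used exactly once, to exclude a real zero of
`ζ_K = ζ · L(·, χ_{d_K})` in `(1 − c/log|d_K|, 1)`. -/
theorem primeClassesSpread_proof :
    Summit.QuantumAdvantage.QuantumAdvantage.Theses.DarkClassGroups.PrimeClassesSpread := by
  intro hi
  classical
  obtain ⟨c, hc, -, hZ⟩ := zetaCont_ne_zero_of_noSiegel hi
  obtain ⟨C₂, hC₂⟩ := perCharacterDeficitκ_of_le_four 2 (by norm_num) (by norm_num) 1 (by norm_num)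
  obtain ⟨C₁, hC₁⟩ := lowerPITκ_of_le_three 2 (by norm_num) (by norm_num) 1
  set C' : ℝ := max (max C₁ C₂) 1 with hC'def
  set L : ℝ := max (max (2 * C') (4 / c)) 25 with hLdef
  refine ⟨⌈Real.exp L⌉₊, ?_⟩
  intro K _ _ h2 hK hN₀ x hx
  -- constants
  have hL25 : (25 : ℝ) ≤ L := le_max_right _ _
  have hLC : 2 * C' ≤ L := le_trans (le_max_left _ _) (le_max_left _ _)
  have hLc : 4 / c ≤ L := le_trans (le_max_right _ _) (le_max_left _ _)
  have hC'1 : 1 ≤ C' := le_max_right _ _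
  have hC₁le : C₁ ≤ C' := le_trans (le_max_left _ _) (le_max_left _ _)
  have hC₂le : C₂ ≤ C' := le_trans (le_max_right _ _) (le_max_left _ _)
  -- the discriminant: `d = |d_K| ≥ e^L ≥ e^25`
  set d : ℝ := |(NumberField.discr K : ℝ)| with hddef
  have hexpL : Real.exp L ≤ d := le_trans (Nat.le_ceil _) hN₀
  have hdpos : 0 < d := lt_of_lt_of_le (Real.exp_pos L) hexpL
  have hlogd : L ≤ Real.log d := by rw [Real.le_log_iff_exp_le hdpos]; exact hexpL
  have hlogd25 : 25 ≤ Real.log d := le_trans hL25 hlogd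
  have hlogdpos : 0 < Real.log d := by linarith
  have hd4 : 4 < d := by
    have h1 : L + 1 ≤ Real.exp L := Real.add_one_le_exp L
    linarith
  have hneg : NumberField.discr K < 0 := discr_neg_of_isTotallyComplex h2 hK
  have hdisc4 : NumberField.discr K < -4 := by
    have h1 : (4 : ℝ) < |(NumberField.discr K : ℝ)| := hd4
    have hnegR : ((NumberField.discr K : ℤ) : ℝ) < 0 := by exact_mod_cast hneg
    rw [abs_of_neg hnegR] at h1
    have h3 : ((NumberField.discr K : ℤ) : ℝ) < -4 := by linarith
    exact_mod_cast h3
  have hd_nat : (((NumberField.discr K).natAbs : ℕ) : ℝ) = d := by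
    rw [hddef, Nat.cast_natAbs, Int.cast_abs]
  -- the residue bound (class number formula)
  have hκ : ThornerZaman.condQn K ^ (-(1 : ℝ)) ≤ NumberField.dedekindZeta_residue K :=
    condQn_rpow_neg_one_le_residue K h2 hdisc4
  -- `x`: `log x ≥ log² d ≥ 625`
  have hlogx : Real.log d ^ 2 ≤ Real.log (x : ℝ) := hx
  have hlogx625 : 625 ≤ Real.log (x : ℝ) := by nlinarith
  have hx0 : 0 < (x : ℝ) := by
    rcases (Nat.cast_nonneg x : (0 : ℝ) ≤ x).eq_or_lt with h | h
    · rw [← h, Real.log_zero] at hlogx625; linarith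
    · exact h
  have hx2 : 2 ≤ (x : ℝ) := by
    by_contra h
    rw [not_le] at h
    have h1 : Real.log (x : ℝ) ≤ Real.log 2 := Real.log_le_log hx0 h.le
    have := Real.log_two_lt_d9
    linarith
  have hx1 : 1 < (x : ℝ) := by linarith
  have hlogxpos : 0 < Real.log (x : ℝ) := by linarith
  -- `Q = 4d`, `Q^{C'} ≤ x`
  set Q : ℝ := ThornerZaman.condQn K with hQdef
  have hQ : Q = d * 4 := by rw [hQdef, ThornerZaman.condQn, h2, hddef]; norm_num
  have hQpos : 0 < Q := by rw [hQ]; positivity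
  have hQ1 : 1 ≤ Q := by rw [hQ]; linarith
  have hlog4 : Real.log 4 < 1.3863 := by
    have : Real.log 4 = 2 * Real.log 2 := by
      rw [show (4 : ℝ) = 2 ^ 2 by norm_num, Real.log_pow]; norm_num
    rw [this]; have := Real.log_two_lt_d9; linarith
  have hlogQ : Real.log Q ≤ 2 * Real.log d := by
    rw [hQ, Real.log_mul hdpos.ne' (by norm_num)]
    have : Real.log 4 ≤ Real.log d := Real.log_le_log (by norm_num) hd4.le
    linarith
  have hQC' : Q ^ C' ≤ (x : ℝ) := by
    rw [← Real.log_le_log_iff (Real.rpow_pos_of_pos hQpos _) hx0, Real.log_rpow hQpos]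
    calc C' * Real.log Q ≤ C' * (2 * Real.log d) := mul_le_mul_of_nonneg_left hlogQ (by linarith)
      _ = (2 * C') * Real.log d := by ring
      _ ≤ L * Real.log d := mul_le_mul_of_nonneg_right hLC hlogdpos.le
      _ ≤ Real.log d * Real.log d := mul_le_mul_of_nonneg_right hlogd hlogdpos.le
      _ = Real.log d ^ 2 := by ring
      _ ≤ Real.log (x : ℝ) := hlogx
  have hQC₁ : Q ^ C₁ ≤ (x : ℝ) := le_trans (Real.rpow_le_rpow_of_exponent_le hQ1 hC₁le) hQC'
  have hQC₂ : Q ^ C₂ ≤ (x : ℝ) := le_trans (Real.rpow_le_rpow_of_exponent_le hQ1 hC₂le) hQC'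
  -- (A) the lower prime ideal theorem at `x`: the nearby-zero alternative contradicts (i)
  have hlowK : 29 * offsetLogIntegral (x : ℝ) ≤ 32 * (primeIdealCount K (x : ℝ) : ℝ) := by
    rcases hC₁ K h2 hκ (x : ℝ) hQC₁ with h | ⟨β₁, -, hβhi, hzero, hnear⟩
    · exact h
    · exfalso
      have hβup : β₁ ≤ 1 - c / Real.log d := by
        by_contra hcon
        rw [not_le] at hcon
        exact hZ K h2 hK β₁ (by rw [hd_nat]; exact hcon) hβhi hzero
      have h1 : c / Real.log d * Real.log (x : ℝ) ≤ (1 - β₁) * Real.log (x : ℝ) :=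
        mul_le_mul_of_nonneg_right (by linarith) hlogxpos.le
      have h2' : c * Real.log d ≤ c / Real.log d * Real.log (x : ℝ) := by
        have e : c / Real.log d * Real.log d ^ 2 = c * Real.log d := by
          field_simp
        calc c * Real.log d = c / Real.log d * Real.log d ^ 2 := e.symm
          _ ≤ c / Real.log d * Real.log (x : ℝ) :=
            mul_le_mul_of_nonneg_left hlogx (div_nonneg hc.le hlogdpos.le)
      have h3 : 4 ≤ c * Real.log d := by
        have h31 : 4 ≤ c * L := by
          have := (div_le_iff₀ hc).1 hLc; linarith
        have h32 : c * L ≤ c * Real.log d := mul_le_mul_of_nonneg_left hlogd hc.le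
        linarith
      linarith
  -- (B) counting over the classes
  set a : ClassGroup (𝓞 K) → ℝ := fun C => ((degOneInClass K x C).ncard : ℝ) with hadef
  have ha0 : ∀ C, 0 ≤ a C := fun C => Nat.cast_nonneg _
  have hP1 : (Set.ncard {P : Ideal (𝓞 K) | P.IsPrime ∧ (Ideal.absNorm P).Prime ∧ Ideal.absNorm P ≤ x} : ℝ)
      = ∑ C : ClassGroup (𝓞 K), a C := by
    rw [ncard_primeNorm_eq_sum K x]
    push_cast
    rfl
  have e1 : ((primeIdealCount K (x : ℝ) : ℕ) : ℝ) ≤ ∑ C : ClassGroup (𝓞 K), a C + 2 * Real.sqrt (x : ℝ) + 2 := by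
    have h1 := primeIdealCount_le_sum_degOneClassCount_add K hx0.le
    rw [h2] at h1
    have h3 : ∑ C : ClassGroup (𝓞 K), (degOneClassCount K C (x : ℝ) : ℝ) = ∑ C : ClassGroup (𝓞 K), a C := by
      refine Finset.sum_congr rfl fun C _ => ?_
      rw [hadef, degOneClassCount_natCast]
    rw [h3] at h1
    push_cast at h1
    linarith
  -- `Li(x) ≥ x/log x − 2` and the lower-order terms
  have hLi : (x : ℝ) / Real.log (x : ℝ) - 2 ≤ offsetLogIntegral (x : ℝ) := by
    have h1 := sub_mul_inv_log_pow_le_offsetLogIntegralPow 1 hx2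
    rw [offsetLogIntegralPow_one, pow_one, ← div_eq_mul_inv] at h1
    have h3 : (x : ℝ) / Real.log (x : ℝ) - 2 ≤ ((x : ℝ) - 2) / Real.log (x : ℝ) := by
      rw [sub_div]
      have : 2 / Real.log (x : ℝ) ≤ 2 := by
        rw [div_le_iff₀ hlogxpos]; nlinarith
      linarith
    linarith
  have hsmall := lowerOrder_le hx0 hlogx625
  have hsqrt0 : 0 ≤ Real.sqrt (x : ℝ) := Real.sqrt_nonneg _
  have hrpow0 : 0 ≤ (x : ℝ) ^ ((9 : ℝ) / 10) := Real.rpow_nonneg hx0.le _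
  set T : ℝ := ∑ C : ClassGroup (𝓞 K), a C with hTdef
  -- `T ≥ (29/32) Li − 2√x − 2`
  have hT : 29 * offsetLogIntegral (x : ℝ) ≤ 32 * (T + 2 * Real.sqrt (x : ℝ) + 2) := by
    nlinarith [hlowK, e1]
  refine ⟨?_, fun M hM => ?_⟩
  · -- (a) abundance
    have hy1 : (1 : ℝ) < (x : ℝ) ^ ((9 : ℝ) / 10) := Real.one_lt_rpow hx1 (by norm_num)
    have hpi : (Nat.primeCounting x : ℝ) ≤
        Real.log 4 * (x : ℝ) / Real.log ((x : ℝ) ^ ((9 : ℝ) / 10)) + (x : ℝ) ^ ((9 : ℝ) / 10) := by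
      have := primeCounting_le_log4_mul_div_log_add hx0.le hy1
      rwa [Nat.floor_natCast] at this
    rw [Real.log_rpow hx0] at hpi
    have hpi2 : (Nat.primeCounting x : ℝ) ≤ 1.5404 * ((x : ℝ) / Real.log (x : ℝ)) + (x : ℝ) ^ ((9 : ℝ) / 10) := by
      have e : Real.log 4 * (x : ℝ) / ((9 : ℝ) / 10 * Real.log (x : ℝ)) =
          (10 / 9 * Real.log 4) * ((x : ℝ) / Real.log (x : ℝ)) := by
        field_simp
      rw [e] at hpi
      have hX0 : 0 ≤ (x : ℝ) / Real.log (x : ℝ) := by positivity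
      have : (10 / 9 * Real.log 4) * ((x : ℝ) / Real.log (x : ℝ)) ≤ 1.5404 * ((x : ℝ) / Real.log (x : ℝ)) :=
        mul_le_mul_of_nonneg_right (by linarith) hX0
      linarith
    have hgoal : (Nat.primeCounting x : ℝ) ≤
        3 * (Set.ncard {P : Ideal (𝓞 K) | P.IsPrime ∧ (Ideal.absNorm P).Prime ∧ Ideal.absNorm P ≤ x} : ℝ) := by
      rw [hP1]
      linarith [hT, hLi, hsmall, hpi2, hsqrt0, hrpow0]
    exact_mod_cast hgoal
  · -- (b) non-concentration: the subgroup-orthogonality lever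
    have hIn : (Set.ncard {P : Ideal (𝓞 K) | P.IsPrime ∧ (Ideal.absNorm P).Prime ∧ Ideal.absNorm P ≤ x ∧
        ∃ hP : P ∈ nonZeroDivisors (Ideal (𝓞 K)), ClassGroup.mk0 ⟨P, hP⟩ ∈ M} : ℝ)
        = ∑ C ∈ Finset.univ.filter (fun C : ClassGroup (𝓞 K) => C ∈ M), a C := by
      rw [ncard_primeNorm_mem_eq_sum K x M]
      push_cast
      rfl
    have hidx : (2 : ℝ) ≤ M.index := by
      have h1 : M.index ≠ 1 := fun h => hM (Subgroup.index_eq_one.mp h)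
      have h3 : M.index ≠ 0 := Subgroup.index_ne_zero_of_finite
      exact_mod_cast (show 2 ≤ M.index by omega)
    have horth : (M.index : ℝ) * ∑ C ∈ Finset.univ.filter (fun C : ClassGroup (𝓞 K) => C ∈ M), a C
        ≤ ∑ C, a C + ((M.index : ℝ) - 1) * (offsetLogIntegral (x : ℝ) / 8) := by
      refine CubicEscape.index_mul_sum_filter_mem_le M a (offsetLogIntegral (x : ℝ) / 8) ?_
      intro χ hχ _
      have h := hC₂ K h2 hκ χ hχ (x : ℝ) hQC₂
      have h' : ∑ C : ClassGroup (𝓞 K), ((χ C : ℂ)).re * (degOneClassCount K C (x : ℝ) : ℝ)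
          = ∑ C : ClassGroup (𝓞 K), ((χ C : ℂ)).re * a C := by
        refine Finset.sum_congr rfl fun C _ => ?_
        rw [hadef, degOneClassCount_natCast]
      rw [h'] at h
      linarith
    set In : ℝ := ∑ C ∈ Finset.univ.filter (fun C : ClassGroup (𝓞 K) => C ∈ M), a C with hIndef
    have hIn0 : 0 ≤ In := Finset.sum_nonneg fun C _ => ha0 C
    have hT0 : 0 ≤ T := Finset.sum_nonneg fun C _ => ha0 C
    have hLi0 : 0 ≤ offsetLogIntegral (x : ℝ) := by
      have : (2 : ℝ) ≤ (x : ℝ) / Real.log (x : ℝ) := by linarith [hsmall, hsqrt0, hrpow0]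
      linarith
    -- `m · In ≤ T + (m−1) Li/8 ≤ T + m Li/8`, so `2 In ≤ m In ≤ T + m Li/8` … i.e. `In ≤ T/m + Li/8 ≤ T/2 + Li/8`
    have hIn2 : 2 * In ≤ T + offsetLogIntegral (x : ℝ) / 4 := by
      set m : ℝ := (M.index : ℝ) with hmdef
      -- from `m In ≤ T + (m−1) L'`: `m (In − L') ≤ T − L'`; if `In ≤ L'` fine, else `2 (In − L') ≤ m (In − L') ≤ T − L'`
      set L' : ℝ := offsetLogIntegral (x : ℝ) / 8 with hL'def
      have h1 : m * (In - L') ≤ T - L' := by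
        have e : m * (In - L') = m * In - (m - 1) * L' - L' := by ring
        rw [e]; linarith
      by_cases hcase : In ≤ L'
      · linarith
      · rw [not_le] at hcase
        have h4 : 2 * (In - L') ≤ m * (In - L') := mul_le_mul_of_nonneg_right hidx (by linarith)
        linarith
    -- `T ≥ Li/2`
    have hTLi : offsetLogIntegral (x : ℝ) ≤ 2 * T := by
      nlinarith [hT, hLi, hsmall, hsqrt0, hrpow0]
    have hgoal : 4 * (Set.ncard {P : Ideal (𝓞 K) | P.IsPrime ∧ (Ideal.absNorm P).Prime ∧ Ideal.absNorm P ≤ x ∧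
        ∃ hP : P ∈ nonZeroDivisors (Ideal (𝓞 K)), ClassGroup.mk0 ⟨P, hP⟩ ∈ M} : ℝ) ≤
        3 * (Set.ncard {P : Ideal (𝓞 K) | P.IsPrime ∧ (Ideal.absNorm P).Prime ∧ Ideal.absNorm P ≤ x} : ℝ) := by
      rw [hIn, hP1]
      linarith
    exact_mod_cast hgoal

end Summit.QuantumAdvantage.QuantumAdvantage.Theorems.PrimeClassesSpread

end
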